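import Summits.ValiantsHypothesis.ValiantsHypothesis.Theses.NewtonUnitEquations

/-!
# The TORIC JACOBIAN of a rank-two composition: chain rule (composition ↦ product) and support bound — TWO-LEMMA LIFT

Lift (val-lit-p3 g18, desk #454, R347 (4) helper lane; critic of record val-idea-crit-8 g3) of the two KERNEL lemmas of val-idea-35 g9's crux workfile
`Cruxes/TwoProducts/RankTwoJacobian_val_idea_35_g9.lean` (@a44f4933fe8f, sha16 2ca45ca5d7209136): the definitions `emb`, `nv`, `theta` (Euler derivation
`θᵢ = Xᵢ∂ᵢ`), `jac` (toric Jacobian `J(F,G) = θ₀F·θ₁G − θ₁F·θ₀G`), the typed statements `ChainRule` (Lemma 3) and `JacSupportBound` (Lemma 5), and their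
proofs ★ `chainRule : ChainRule` (`J(P(w₁,w₂), w₁) = (∂_{W₂}P)(w₁,w₂) · J(w₂,w₁)` — COMPOSITION ↦ PRODUCT, via `jacDer` and `jacDer_map_aeval`,
the chain rule for derivations along polynomial maps SPECIALISED to `jacDer` on `ℂ[x,y]` — the general statement is the tree's
✓ `Literature.ModelTheory.PseudofiniteFields.Derivation.map_mvPolynomial_aeval`, whose module lies outside the Valiant build cone, hence the
specialised inline form, same induction) and
★ `jacSupportBound : JacSupportBound` (`supp J(F,G) ⊆ supp F + supp G`, so `≤ |supp F|·|supp G|` monomials and `nv ≤` that), with exactly the helper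
lemmas they use (`jac_self`, `jacDer_apply`, `theta_monomial`, `theta_eq_sum`, `support_theta_subset`, `support_jac_subset`, `card_support_jac_le`,
`nv_le_card_support`) — bodies VERBATIM, namespace `…Cruxes.TwoProducts.ValIdea35g9` → `…Theorems.TwoProducts.RankTwoJacobian`.
NOT lifted (they stay in idea-35's workfile, unfinished): `AxialTransfer`, `Ostrowski`, `DependentCase`, the counting, `RankTwoExplicitBound` /
`RankTwoCompositionLaw` / `JacobianTransferBound` / `PortPlan`.
HONEST LABEL: helper lemmas for the SIDE ladder «table-rank-ladder» (K13 K1, VERDICT #26 (U1)) of crux `stmt-ValiantsHypothesis-5906` (`TwoProducts`);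
nothing here closes 5906 / `PlanarCellBound` / `ResidualLawV25`; the rank-two composition law itself is paper-only; VP ≠ VNP is NOT proved.
`--supports stmt-ValiantsHypothesis-5906 --as helper`.  Credit: val-idea-35 g9 (objects, statements, proofs).  No instances, no notation, no named facts. [folklore]
-/

noncomputable section
set_option linter.dupNamespace false

namespace Summit.ValiantsHypothesis.ValiantsHypothesis.Theorems.TwoProducts.RankTwoJacobian

open scoped BigOperators Pointwise
open MvPolynomial

/-- Bivariate complex polynomials. -/
abbrev Poly2 := MvPolynomial (Fin 2) ℂ

/-- Planar embedding of an exponent (as in `TwoProducts` and the g8 ladder file). -/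
def emb : (Fin 2 →₀ ℕ) → (Fin 2 → ℝ) := fun e i => ((e i : ℕ) : ℝ)

/-- Number of vertices of the Newton polygon of `D` (as in `TwoProducts` and the g8 ladder file). -/
def nv (D : Poly2) : ℕ :=
  (Set.extremePoints ℝ (convexHull ℝ (emb '' (D.support : Set (Fin 2 →₀ ℕ))))).ncard

/-- Euler derivation `θᵢ = Xᵢ ∂ᵢ` (acts on monomials by `X^α ↦ αᵢ X^α`). -/
def theta (i : Fin 2) (F : Poly2) : Poly2 := X i * pderiv i F

/-- Toric Jacobian `J(F,G) = θ₀F·θ₁G − θ₁F·θ₀G`; on monomials `J(X^α, X^β) = det(α,β)·X^{α+β}`.  Bilinear,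
antisymmetric, a derivation in each slot, kills constants; `J(F,G) = 0` iff `F, G` are algebraically dependent. -/
def jac (F G : Poly2) : Poly2 := theta 0 F * theta 1 G - theta 1 F * theta 0 G

/-- LEMMA 3 (chain rule for the biderivation `J`; memo §1): COMPOSITION ↦ PRODUCT. -/
def ChainRule : Prop :=
  ∀ (P w₁ w₂ : Poly2),
    jac (MvPolynomial.aeval ![w₁, w₂] P) w₁ = MvPolynomial.aeval ![w₁, w₂] (pderiv 1 P) * jac w₂ w₁

/-- LEMMA 5 (memo §1): `supp J(F,G) ⊆ supp F + supp G`, so `J(w₂,w₁)` has `≤ t²` monomials and `nv ≤ t²`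
(EPRS08: `O(t^{4/3})` vertices, as a convexly independent subset of `S₁+S₂`). -/
def JacSupportBound : Prop :=
  ∀ (F G : Poly2), (jac F G).support.card ≤ F.support.card * G.support.card ∧ nv (jac F G) ≤ (jac F G).support.card

/-- `J` is alternating: `J(F, F) = 0`. -/
theorem jac_self (F : Poly2) : jac F F = 0 := by
  simp [jac, theta]; ring

/-- `F ↦ J(F, G)` as a `ℂ`-derivation of `ℂ[x,y]`. -/
def jacDer (G : Poly2) : Derivation ℂ Poly2 Poly2 :=
  (X 0 * theta 1 G) • (pderiv 0 : Derivation ℂ Poly2 Poly2) -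
    (X 1 * theta 0 G) • (pderiv 1 : Derivation ℂ Poly2 Poly2)

/-- `jacDer G F = J(F, G)`. [folklore] -/
theorem jacDer_apply (G F : Poly2) : jacDer G F = jac F G := by
  simp only [jacDer, Derivation.sub_apply, Derivation.smul_apply, smul_eq_mul, jac, theta]
  ring

set_option maxHeartbeats 400000 in
/-- Chain rule for the derivation `jacDer G` along polynomial maps: `J(p(a), G) = Σ_i (∂_i p)(a) · J(a_i, G)` — the specialisation to
`ℂ[x,y]` and `D = jacDer G` of the tree's ✓ `Literature.ModelTheory.PseudofiniteFields.Derivation.map_mvPolynomial_aeval` (same induction; inlined in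
specialised form because that Literature module is outside the Valiant build cone). [folklore] -/
theorem jacDer_map_aeval (G : Poly2) (a : Fin 2 → Poly2) (p : Poly2) :
    jacDer G (aeval a p) = ∑ i, aeval a (pderiv i p) * jacDer G (a i) := by
  induction p using MvPolynomial.induction_on with
  | C r => simp
  | add p q hp hq =>
    simp only [map_add, hp, hq, add_mul, Finset.sum_add_distrib]
  | mul_X p s hp =>
    have hX : ∀ i : Fin 2, aeval a (pderiv i (X s : Poly2)) = if s = i then (1 : Poly2) else 0 := by
      intro i
      rw [pderiv_X, Pi.single_apply]
      split_ifs <;> simp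
    have hR : ∀ i, aeval a (pderiv i (p * X s)) * jacDer G (a i) =
        (a s * aeval a (pderiv i p)) * jacDer G (a i) + (if s = i then aeval a p * jacDer G (a i) else 0) := by
      intro i
      rw [Derivation.leibniz, map_add, smul_eq_mul, smul_eq_mul, map_mul, map_mul, aeval_X, hX,
        add_mul, add_comm]
      congr 1
      split_ifs <;> simp
    rw [map_mul, aeval_X, Derivation.leibniz, hp]
    simp_rw [hR, Finset.sum_add_distrib, Finset.sum_ite_eq, Finset.mem_univ, if_true, smul_eq_mul]
    rw [add_comm, Finset.mul_sum]
    congr 1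
    refine Finset.sum_congr rfl fun i _ => ?_
    ring

/-- **LEMMA 3 in the kernel** (`ChainRule`): `J(P(w₁,w₂), w₁) = (∂_{W₂}P)(w₁,w₂) · J(w₂,w₁)` — composition ↦ product. -/
theorem chainRule : ChainRule := by
  intro P w₁ w₂
  have h := jacDer_map_aeval w₁ ![w₁, w₂] P
  rw [jacDer_apply] at h
  rw [h, Fin.sum_univ_two]
  simp only [jacDer_apply, Matrix.cons_val_zero, Matrix.cons_val_one, jac_self,
    mul_zero, zero_add]

/-- `θᵢ` on a monomial: `θᵢ(a X^s) = a·sᵢ X^s`. [folklore] -/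
theorem theta_monomial (i : Fin 2) (s : Fin 2 →₀ ℕ) (a : ℂ) :
    theta i (monomial s a) = monomial s (a * (s i : ℂ)) := by
  unfold theta
  rw [pderiv_monomial]
  by_cases h : s i = 0
  · simp [h]
  · rw [show (X i : Poly2) = monomial (Finsupp.single i 1) 1 from rfl, monomial_mul, one_mul,
      add_tsub_cancel_of_le (Finsupp.single_le_iff.mpr (Nat.one_le_iff_ne_zero.mpr h))]

/-- `θᵢ F` as a sum over the support of `F`. [folklore] -/
theorem theta_eq_sum (i : Fin 2) (F : Poly2) :
    theta i F = ∑ s ∈ F.support, monomial s (coeff s F * (s i : ℂ)) := by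
  conv_lhs => rw [F.as_sum]
  unfold theta
  rw [map_sum, Finset.mul_sum]
  refine Finset.sum_congr rfl fun s _ => ?_
  have := theta_monomial i s (coeff s F)
  unfold theta at this
  exact this

/-- `θᵢ` does not enlarge supports. -/
theorem support_theta_subset (i : Fin 2) (F : Poly2) : (theta i F).support ⊆ F.support := by
  rw [theta_eq_sum]
  intro e he
  obtain ⟨s, hs, hes⟩ := Finset.mem_biUnion.mp (MvPolynomial.support_sum he)
  have := MvPolynomial.support_monomial_subset hes
  rw [Finset.mem_singleton] at this
  rwa [this]

/-- LEMMA 5(a): `supp J(F,G) ⊆ supp F + supp G`. -/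
theorem support_jac_subset (F G : Poly2) : (jac F G).support ⊆ F.support + G.support := by
  unfold jac
  refine (MvPolynomial.support_sub ..).trans (Finset.union_subset ?_ ?_)
  · exact (MvPolynomial.support_mul _ _).trans
      (Finset.add_subset_add (support_theta_subset 0 F) (support_theta_subset 1 G))
  · exact (MvPolynomial.support_mul _ _).trans
      (Finset.add_subset_add (support_theta_subset 1 F) (support_theta_subset 0 G))

/-- LEMMA 5(b): `J(F,G)` has at most `|supp F|·|supp G|` monomials. -/
theorem card_support_jac_le (F G : Poly2) : (jac F G).support.card ≤ F.support.card * G.support.card :=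
  (Finset.card_le_card (support_jac_subset F G)).trans Finset.card_add_le

/-- A Newton polygon has at most as many vertices as its polynomial has monomials. -/
theorem nv_le_card_support (D : Poly2) : nv D ≤ D.support.card := by
  unfold nv
  have hfin : (emb '' (D.support : Set (Fin 2 →₀ ℕ))).Finite := (D.support.finite_toSet).image _
  calc (Set.extremePoints ℝ (convexHull ℝ (emb '' (D.support : Set (Fin 2 →₀ ℕ))))).ncard
      ≤ (emb '' (D.support : Set (Fin 2 →₀ ℕ))).ncard :=
        Set.ncard_le_ncard (extremePoints_convexHull_subset) hfin
    _ ≤ (D.support : Set (Fin 2 →₀ ℕ)).ncard := Set.ncard_image_le D.support.finite_toSet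
    _ = D.support.card := Set.ncard_coe_finset _

/-- **LEMMA 5 in the kernel** (`JacSupportBound`). -/
theorem jacSupportBound : JacSupportBound := fun F G =>
  ⟨card_support_jac_le F G, nv_le_card_support _⟩

end Summit.ValiantsHypothesis.ValiantsHypothesis.Theorems.TwoProducts.RankTwoJacobian

end
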